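import Mathlib.MeasureTheory.Integral.RieszMarkovKakutani.Real
import HarnessLib

/-!
# Extension of a positive linear functional from a sandwiching function space to a Radon measure

Topic `MeasureTheory/RieszRepresentation`; namespace `Literature.MeasureTheory.RieszRepresentation`.
KERNEL MATHEMATICS ONLY: no `def … : Prop` records of unproved facts, no `axiom`, no `sorry`; every
`[cite: …]` tag is provenance for a kernel-checked statement.

Setting. `X` is a topological space, `L` an `ℝ`-linear subspace of the real functions on `X`
(`Submodule ℝ (X → ℝ)`) and `S : L →ₗ[ℝ] ℝ` a **positive** linear functional (`0 ≤ Ψ ⇒ 0 ≤ S Ψ`).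
We say that `(L, S)` **sandwiches** `C_c(X, ℝ)` (hypothesis `hL` throughout) if every compactly supported
continuous `g` admits, for every `ε > 0`, elements `Ψ₁ ≤ g ≤ Ψ₂` of `L` with `S Ψ₂ ≤ S Ψ₁ + ε` — the
Darboux–Daniell condition. This is how a positive linear functional on a space of *test functions*
(Schwartz functions on `ℝⁿ`, Schwartz–Bruhat functions on an adelic space, which are neither contained
in nor contain `C_c`) is turned into an honest positive Radon measure: L. Schwartz's "a positive
distribution is a positive measure", in the form used by Weil for positive tempered distributions
(*Acta Math.* 113 (1965), Chap. I n° 2, Lemme 3, p. 7: "si `T` est une mesure positive, il en est de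
même de `S`").

Results, all proved:

* `upperExtension L S g = inf {S Ψ₂ : g ≤ Ψ₂ ∈ L}` — the Daniell upper integral; under the sandwich condition
  it is additive, homogeneous and positive on `C_c(X, ℝ)` and is packaged as the positive linear
  functional `sandwichFunctional : C_c(X, ℝ) →ₚ[ℝ] ℝ`; it is squeezed by every sandwich
  (`le_sandwichFunctional`, `sandwichFunctional_le`) and agrees with `S` on `L ∩ C_c`
  (`sandwichFunctional_eq_of_coe_eq`).
* `sandwichMeasure` — for `X` locally compact Hausdorff with its Borel σ-algebra, the
  Riesz–Markov–Kakutani measure of `sandwichFunctional` (Mathlib `RealRMK.rieszMeasure`,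
  [Rudin, *Real and Complex Analysis*, Thm. 2.14]): a regular Borel measure `ν` with
  `∫ g dν = sandwichFunctional g` (`integral_sandwichMeasure`).
* `setLIntegral_sandwichMeasure_le` / `lintegral_sandwichMeasure_le` / `integral_sandwichMeasure_le_of_mem`
  — every continuous nonnegative `Ψ ∈ L` is `ν`-integrable with `∫ Ψ dν ≤ S Ψ` (on compact sets; globally
  for `σ`-compact `X`), with equality `∫ Ψ dν = S Ψ` when `Ψ` is approximated in the `S`-seminorm by
  compactly supported elements of `L` (`integral_sandwichMeasure_eq_of_mem`, the tightness clause).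
* `sandwichMeasure_apply_eq_zero_of_forall` — an open set all of whose test functions are killed by
  `sandwichFunctional` is `ν`-null (support control).
* `sandwichFunctional_comp_homeomorph` / `map_sandwichMeasure_eq` — invariance: a homeomorphism `T`
  with `L ∘ T ⊆ L` and `S (Ψ ∘ T) = S Ψ` fixes `sandwichFunctional` and `ν`
  (uniqueness half of Riesz–Markov–Kakutani, Mathlib `Measure.ext_of_integral_eq_on_compactlySupported`).

Consumers: the fibre measures `μ_b` of Weil's Siegel–Eisenstein measure `E_X = Σ_b μ_b`
(`NumberTheory/Weil1965/AdelicFibreMeasures`, from the positive functional `Φ ↦ Σ_ξ F*_Φ(ξ)` on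
`𝒮(X_𝔸)` of `NumberTheory/Automorphic/AdeleQuotientFejerLimit`) and their theta-side counterparts.

## References

* W. Rudin, *Real and Complex Analysis*, 3rd ed. (1987), Thm. 2.14 (Riesz representation theorem for
  positive linear functionals on `C_c(X)`) and Thm. 2.18 [Rudin1987].
* A. Weil, *Sur la formule de Siegel dans la théorie des groupes classiques*, Acta Math. 113 (1965),
  1–87: Chap. I n° 2, Lemmes 2–3, p. 7 [Weil1965].
-/

noncomputable section

open MeasureTheory Topology Filter Set CompactlySupported

namespace Literature.MeasureTheory.RieszRepresentation

variable {X : Type*}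

/-! ### The Daniell upper integral of a positive functional on a function space -/

section Order

variable (L : Submodule ℝ (X → ℝ)) (S : L →ₗ[ℝ] ℝ)

/-- The set of values `S Ψ₂` over the upper functions `Ψ₂ ∈ L`, `g ≤ Ψ₂`, of a real function `g`.
[cite: Rudin1987, Ch. 2, Thm. 2.14] -/
def upperValues (g : X → ℝ) : Set ℝ :=
  (fun Ψ : L => S Ψ) '' {Ψ : L | g ≤ (Ψ : X → ℝ)}

/-- The **Daniell upper integral** `inf {S Ψ₂ : Ψ₂ ∈ L, g ≤ Ψ₂}` of a real function `g` relative to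
the functional `S` on `L` (equal to the lower integral `sup {S Ψ₁ : L ∋ Ψ₁ ≤ g}` on sandwiched
functions, `le_upperExtension` / `upperExtension_le`). [cite: Rudin1987, Ch. 2, Thm. 2.14] -/
def upperExtension (g : X → ℝ) : ℝ :=
  sInf (upperValues L S g)

variable {L S}

/-- A positive functional is monotone. [cite: Rudin1987, Ch. 2, Thm. 2.14] -/
theorem apply_mono (hS : ∀ Ψ : L, 0 ≤ (Ψ : X → ℝ) → 0 ≤ S Ψ) {Ψ₁ Ψ₂ : L}
    (h : (Ψ₁ : X → ℝ) ≤ Ψ₂) : S Ψ₁ ≤ S Ψ₂ := by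
  have h0 : 0 ≤ ((Ψ₂ - Ψ₁ : L) : X → ℝ) := by
    intro x
    simp only [Submodule.coe_sub, Pi.zero_apply, Pi.sub_apply, sub_nonneg]
    exact h x
  have := hS _ h0
  rwa [map_sub, sub_nonneg] at this

/-- `|S Ψ| ≤ S Θ` whenever `|Ψ| ≤ Θ` pointwise, for a positive functional `S`.
[cite: Rudin1987, Ch. 2, Thm. 2.14] -/
theorem abs_apply_le (hS : ∀ Ψ : L, 0 ≤ (Ψ : X → ℝ) → 0 ≤ S Ψ) {Ψ Θ : L}
    (h : ∀ x, |(Ψ : X → ℝ) x| ≤ (Θ : X → ℝ) x) : |S Ψ| ≤ S Θ := by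
  rw [abs_le]
  constructor
  · have h0 : 0 ≤ ((Θ + Ψ : L) : X → ℝ) := by
      intro x
      simp only [Submodule.coe_add, Pi.zero_apply, Pi.add_apply]
      have := (abs_le.mp (h x)).1
      linarith
    have := hS _ h0
    rw [map_add] at this
    linarith
  · have h0 : 0 ≤ ((Θ - Ψ : L) : X → ℝ) := by
      intro x
      simp only [Submodule.coe_sub, Pi.zero_apply, Pi.sub_apply, sub_nonneg]
      exact (abs_le.mp (h x)).2
    have := hS _ h0
    rw [map_sub] at this
    linarith

/-- Lower functions have smaller `S`-value than upper functions. [cite: Rudin1987, Ch. 2, Thm. 2.14] -/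
theorem apply_le_apply_of_le_of_le (hS : ∀ Ψ : L, 0 ≤ (Ψ : X → ℝ) → 0 ≤ S Ψ) {g : X → ℝ}
    {Ψ₁ Ψ₂ : L} (h₁ : (Ψ₁ : X → ℝ) ≤ g) (h₂ : g ≤ (Ψ₂ : X → ℝ)) : S Ψ₁ ≤ S Ψ₂ :=
  apply_mono hS (h₁.trans h₂)

/-- The upper values of a function with a lower function are bounded below.
[cite: Rudin1987, Ch. 2, Thm. 2.14] -/
theorem bddBelow_upperValues (hS : ∀ Ψ : L, 0 ≤ (Ψ : X → ℝ) → 0 ≤ S Ψ) {g : X → ℝ}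
    (h : ∃ Ψ₁ : L, (Ψ₁ : X → ℝ) ≤ g) : BddBelow (upperValues L S g) := by
  obtain ⟨Ψ₁, h₁⟩ := h
  refine ⟨S Ψ₁, ?_⟩
  rintro _ ⟨Ψ₂, h₂, rfl⟩
  exact apply_le_apply_of_le_of_le hS h₁ h₂

/-- The upper values of a function with an upper function are nonempty.
[cite: Rudin1987, Ch. 2, Thm. 2.14] -/
theorem upperValues_nonempty {g : X → ℝ} (h : ∃ Ψ₂ : L, g ≤ (Ψ₂ : X → ℝ)) :
    (upperValues L S g).Nonempty := by
  obtain ⟨Ψ₂, h₂⟩ := h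
  exact ⟨S Ψ₂, Ψ₂, h₂, rfl⟩

/-- The upper integral is below the `S`-value of every upper function.
[cite: Rudin1987, Ch. 2, Thm. 2.14] -/
theorem upperExtension_le (hS : ∀ Ψ : L, 0 ≤ (Ψ : X → ℝ) → 0 ≤ S Ψ) {g : X → ℝ}
    (hlow : ∃ Ψ₁ : L, (Ψ₁ : X → ℝ) ≤ g) {Ψ₂ : L} (h₂ : g ≤ (Ψ₂ : X → ℝ)) :
    upperExtension L S g ≤ S Ψ₂ :=
  csInf_le (bddBelow_upperValues hS hlow) ⟨Ψ₂, h₂, rfl⟩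

/-- The upper integral is above the `S`-value of every lower function.
[cite: Rudin1987, Ch. 2, Thm. 2.14] -/
theorem le_upperExtension (hS : ∀ Ψ : L, 0 ≤ (Ψ : X → ℝ) → 0 ≤ S Ψ) {g : X → ℝ}
    (hup : ∃ Ψ₂ : L, g ≤ (Ψ₂ : X → ℝ)) {Ψ₁ : L} (h₁ : (Ψ₁ : X → ℝ) ≤ g) :
    S Ψ₁ ≤ upperExtension L S g := by
  refine le_csInf (upperValues_nonempty hup) ?_
  rintro _ ⟨Ψ₂, h₂, rfl⟩
  exact apply_le_apply_of_le_of_le hS h₁ h₂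

end Order

section Daniell

variable [TopologicalSpace X] (L : Submodule ℝ (X → ℝ)) (S : L →ₗ[ℝ] ℝ)

variable {L S}
variable (hS : ∀ Ψ : L, 0 ≤ (Ψ : X → ℝ) → 0 ≤ S Ψ)
  (hL : ∀ g : C_c(X, ℝ), ∀ ε : ℝ, 0 < ε →
    ∃ Ψ₁ Ψ₂ : L, (Ψ₁ : X → ℝ) ≤ g ∧ (g : X → ℝ) ≤ Ψ₂ ∧ S Ψ₂ ≤ S Ψ₁ + ε)

include hS hL

/-! Throughout, `hS` is positivity of `S` and `hL` the **sandwich (Darboux–Daniell) condition**: every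
`g ∈ C_c(X, ℝ)` lies between two elements `Ψ₁ ≤ g ≤ Ψ₂` of `L` whose `S`-values are arbitrarily close
[Weil 1965, Chap. I n° 2, Lemme 3, p. 7: the condition under which `S` "is" a positive measure]. -/

/-- Under the sandwich condition, every test function has a sandwich `Ψ₁ ≤ g ≤ Ψ₂` in `L` with
`S Ψ₂ ≤ S Ψ₁ + ε` squeezing the upper integral: `S Ψ₁ ≤ Λ g ≤ S Ψ₂`.
[cite: Rudin1987, Ch. 2, Thm. 2.14] -/
theorem exists_sandwich
    (g : C_c(X, ℝ)) {ε : ℝ} (hε : 0 < ε) :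
    ∃ Ψ₁ Ψ₂ : L, (Ψ₁ : X → ℝ) ≤ g ∧ (g : X → ℝ) ≤ Ψ₂ ∧ S Ψ₂ ≤ S Ψ₁ + ε ∧
      S Ψ₁ ≤ upperExtension L S g ∧ upperExtension L S g ≤ S Ψ₂ := by
  obtain ⟨Ψ₁, Ψ₂, h₁, h₂, h⟩ := hL g ε hε
  exact ⟨Ψ₁, Ψ₂, h₁, h₂, h, le_upperExtension hS ⟨Ψ₂, h₂⟩ h₁,
    upperExtension_le hS ⟨Ψ₁, h₁⟩ h₂⟩

/-- Additivity of the upper integral on test functions. [cite: Rudin1987, Ch. 2, Thm. 2.14] -/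
theorem upperExtension_add
    (g g' : C_c(X, ℝ)) :
    upperExtension L S ⇑(g + g') = upperExtension L S g + upperExtension L S g' := by
  refine le_antisymm (le_of_forall_pos_le_add fun ε hε => ?_)
    (le_of_forall_pos_le_add fun ε hε => ?_)
  · obtain ⟨Ψ₁, Ψ₂, h₁, h₂, h, hl, hu⟩ := exists_sandwich hS hL g (half_pos hε)
    obtain ⟨Ψ₁', Ψ₂', h₁', h₂', h', hl', hu'⟩ := exists_sandwich hS hL g' (half_pos hε)
    have hlow : ∃ Φ : L, (Φ : X → ℝ) ≤ ⇑(g + g') :=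
      ⟨Ψ₁ + Ψ₁', fun x => by
        simp only [Submodule.coe_add, Pi.add_apply, CompactlySupportedContinuousMap.coe_add]
        exact add_le_add (h₁ x) (h₁' x)⟩
    have hup : (⇑(g + g') : X → ℝ) ≤ ((Ψ₂ + Ψ₂' : L) : X → ℝ) := fun x => by
      simp only [Submodule.coe_add, Pi.add_apply, CompactlySupportedContinuousMap.coe_add]
      exact add_le_add (h₂ x) (h₂' x)
    calc upperExtension L S ⇑(g + g') ≤ S (Ψ₂ + Ψ₂') := upperExtension_le hS hlow hup
      _ = S Ψ₂ + S Ψ₂' := map_add S _ _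
      _ ≤ upperExtension L S g + upperExtension L S g' + ε := by linarith
  · obtain ⟨Ψ₁, Ψ₂, h₁, h₂, h, hl, hu⟩ := exists_sandwich hS hL g (half_pos hε)
    obtain ⟨Ψ₁', Ψ₂', h₁', h₂', h', hl', hu'⟩ := exists_sandwich hS hL g' (half_pos hε)
    have hup : ∃ Φ : L, (⇑(g + g') : X → ℝ) ≤ Φ :=
      ⟨Ψ₂ + Ψ₂', fun x => by
        simp only [Submodule.coe_add, Pi.add_apply, CompactlySupportedContinuousMap.coe_add]
        exact add_le_add (h₂ x) (h₂' x)⟩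
    have hlow : ((Ψ₁ + Ψ₁' : L) : X → ℝ) ≤ ⇑(g + g') := fun x => by
      simp only [Submodule.coe_add, Pi.add_apply, CompactlySupportedContinuousMap.coe_add]
      exact add_le_add (h₁ x) (h₁' x)
    calc upperExtension L S g + upperExtension L S g' ≤ S Ψ₁ + S Ψ₁' + ε := by linarith
      _ = S (Ψ₁ + Ψ₁') + ε := by rw [map_add]
      _ ≤ upperExtension L S ⇑(g + g') + ε := by
        have := le_upperExtension hS hup hlow
        linarith

/-- The upper integral commutes with negation on test functions.
[cite: Rudin1987, Ch. 2, Thm. 2.14] -/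
theorem upperExtension_neg
    (g : C_c(X, ℝ)) : upperExtension L S ⇑(-g) = -upperExtension L S g := by
  refine le_antisymm (le_of_forall_pos_le_add fun ε hε => ?_)
    (le_of_forall_pos_le_add fun ε hε => ?_)
  · obtain ⟨Ψ₁, Ψ₂, h₁, h₂, h, hl, hu⟩ := exists_sandwich hS hL g hε
    have hlow : ∃ Φ : L, (Φ : X → ℝ) ≤ ⇑(-g) :=
      ⟨-Ψ₂, fun x => by
        simp only [Submodule.coe_neg, Pi.neg_apply, CompactlySupportedContinuousMap.coe_neg]
        exact neg_le_neg (h₂ x)⟩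
    have hup : (⇑(-g) : X → ℝ) ≤ ((-Ψ₁ : L) : X → ℝ) := fun x => by
      simp only [Submodule.coe_neg, Pi.neg_apply, CompactlySupportedContinuousMap.coe_neg]
      exact neg_le_neg (h₁ x)
    calc upperExtension L S ⇑(-g) ≤ S (-Ψ₁) := upperExtension_le hS hlow hup
      _ = -S Ψ₁ := map_neg S _
      _ ≤ -upperExtension L S g + ε := by linarith
  · obtain ⟨Ψ₁, Ψ₂, h₁, h₂, h, hl, hu⟩ := exists_sandwich hS hL g hε
    have hup : ∃ Φ : L, (⇑(-g) : X → ℝ) ≤ Φ :=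
      ⟨-Ψ₁, fun x => by
        simp only [Submodule.coe_neg, Pi.neg_apply, CompactlySupportedContinuousMap.coe_neg]
        exact neg_le_neg (h₁ x)⟩
    have hlow : ((-Ψ₂ : L) : X → ℝ) ≤ ⇑(-g) := fun x => by
      simp only [Submodule.coe_neg, Pi.neg_apply, CompactlySupportedContinuousMap.coe_neg]
      exact neg_le_neg (h₂ x)
    calc -upperExtension L S g ≤ -S Ψ₂ + ε := by linarith
      _ = S (-Ψ₂) + ε := by rw [map_neg]
      _ ≤ upperExtension L S ⇑(-g) + ε := by
        have := le_upperExtension hS hup hlow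
        linarith

/-- Positive homogeneity of the upper integral on test functions.
[cite: Rudin1987, Ch. 2, Thm. 2.14] -/
theorem upperExtension_smul_of_nonneg
 {c : ℝ} (hc : 0 ≤ c) (g : C_c(X, ℝ)) :
    upperExtension L S ⇑(c • g) = c * upperExtension L S g := by
  have hε' : ∀ {ε : ℝ}, 0 < ε → 0 < ε / (c + 1) := fun hε => div_pos hε (by linarith)
  have hcε : ∀ {ε : ℝ}, 0 < ε → c * (ε / (c + 1)) ≤ ε := by
    intro ε hε
    rw [mul_div_assoc']
    rw [div_le_iff₀ (by linarith)]
    nlinarith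
  refine le_antisymm (le_of_forall_pos_le_add fun ε hε => ?_)
    (le_of_forall_pos_le_add fun ε hε => ?_)
  · obtain ⟨Ψ₁, Ψ₂, h₁, h₂, h, hl, hu⟩ := exists_sandwich hS hL g (hε' hε)
    have hlow : ∃ Φ : L, (Φ : X → ℝ) ≤ ⇑(c • g) :=
      ⟨c • Ψ₁, fun x => by
        simp only [Submodule.coe_smul, Pi.smul_apply, CompactlySupportedContinuousMap.coe_smul,
          smul_eq_mul]
        exact mul_le_mul_of_nonneg_left (h₁ x) hc⟩
    have hup : (⇑(c • g) : X → ℝ) ≤ ((c • Ψ₂ : L) : X → ℝ) := fun x => by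
      simp only [Submodule.coe_smul, Pi.smul_apply, CompactlySupportedContinuousMap.coe_smul,
        smul_eq_mul]
      exact mul_le_mul_of_nonneg_left (h₂ x) hc
    calc upperExtension L S ⇑(c • g) ≤ S (c • Ψ₂) := upperExtension_le hS hlow hup
      _ = c * S Ψ₂ := by rw [map_smul, smul_eq_mul]
      _ ≤ c * (S Ψ₁ + ε / (c + 1)) := mul_le_mul_of_nonneg_left h hc
      _ = c * S Ψ₁ + c * (ε / (c + 1)) := by ring
      _ ≤ c * upperExtension L S g + ε :=
        add_le_add (mul_le_mul_of_nonneg_left hl hc) (hcε hε)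
  · obtain ⟨Ψ₁, Ψ₂, h₁, h₂, h, hl, hu⟩ := exists_sandwich hS hL g (hε' hε)
    have hup : ∃ Φ : L, (⇑(c • g) : X → ℝ) ≤ Φ :=
      ⟨c • Ψ₂, fun x => by
        simp only [Submodule.coe_smul, Pi.smul_apply, CompactlySupportedContinuousMap.coe_smul,
          smul_eq_mul]
        exact mul_le_mul_of_nonneg_left (h₂ x) hc⟩
    have hlow : ((c • Ψ₁ : L) : X → ℝ) ≤ ⇑(c • g) := fun x => by
      simp only [Submodule.coe_smul, Pi.smul_apply, CompactlySupportedContinuousMap.coe_smul,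
        smul_eq_mul]
      exact mul_le_mul_of_nonneg_left (h₁ x) hc
    calc c * upperExtension L S g ≤ c * S Ψ₂ := mul_le_mul_of_nonneg_left hu hc
      _ ≤ c * (S Ψ₁ + ε / (c + 1)) := mul_le_mul_of_nonneg_left h hc
      _ = S (c • Ψ₁) + c * (ε / (c + 1)) := by rw [map_smul, smul_eq_mul]; ring
      _ ≤ upperExtension L S ⇑(c • g) + ε :=
        add_le_add (le_upperExtension hS hup hlow) (hcε hε)

/-- Homogeneity of the upper integral on test functions. [cite: Rudin1987, Ch. 2, Thm. 2.14] -/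
theorem upperExtension_smul
    (c : ℝ) (g : C_c(X, ℝ)) :
    upperExtension L S ⇑(c • g) = c * upperExtension L S g := by
  rcases le_or_gt 0 c with hc | hc
  · exact upperExtension_smul_of_nonneg hS hL hc g
  · have hcg : c • g = -((-c) • g) := by
      ext x
      simp
    rw [hcg, upperExtension_neg hS hL, upperExtension_smul_of_nonneg hS hL (by linarith) g]
    ring

/-- Positivity of the upper integral. [cite: Rudin1987, Ch. 2, Thm. 2.14] -/
theorem upperExtension_nonneg
    {g : C_c(X, ℝ)} (hg : 0 ≤ g) : 0 ≤ upperExtension L S g := by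
  obtain ⟨Ψ₁, Ψ₂, h₁, h₂, -⟩ := hL g 1 one_pos
  refine le_csInf (upperValues_nonempty ⟨Ψ₂, h₂⟩) ?_
  rintro _ ⟨Ψ, hΨ, rfl⟩
  exact hS Ψ fun x => (hg x).trans (hΨ x)

/-- **The positive linear functional on `C_c(X, ℝ)` determined by a sandwiching positive functional**
`S` on `L`: `g ↦ inf {S Ψ₂ : g ≤ Ψ₂ ∈ L} = sup {S Ψ₁ : L ∋ Ψ₁ ≤ g}`.
[cite: Rudin1987, Ch. 2, Thm. 2.14] -/
def sandwichFunctional :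
    C_c(X, ℝ) →ₚ[ℝ] ℝ :=
  PositiveLinearMap.mk₀
    { toFun := fun g => upperExtension L S g
      map_add' := fun g g' => upperExtension_add hS hL g g'
      map_smul' := fun c g => by
        rw [RingHom.id_apply, smul_eq_mul]
        exact upperExtension_smul hS hL c g }
    fun g hg => upperExtension_nonneg hS hL hg

/-- Unfolding `sandwichFunctional`. [cite: Rudin1987, Ch. 2, Thm. 2.14] -/
theorem sandwichFunctional_apply
 (g : C_c(X, ℝ)) :
    sandwichFunctional hS hL g = upperExtension L S g := rfl

/-- Lower functions bound `sandwichFunctional` from below. [cite: Rudin1987, Ch. 2, Thm. 2.14] -/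
theorem le_sandwichFunctional
    {g : C_c(X, ℝ)} {Ψ₁ : L} (h₁ : (Ψ₁ : X → ℝ) ≤ g) : S Ψ₁ ≤ sandwichFunctional hS hL g := by
  obtain ⟨-, Ψ₂, -, h₂, -⟩ := hL g 1 one_pos
  exact le_upperExtension hS ⟨Ψ₂, h₂⟩ h₁

/-- Upper functions bound `sandwichFunctional` from above. [cite: Rudin1987, Ch. 2, Thm. 2.14] -/
theorem sandwichFunctional_le
    {g : C_c(X, ℝ)} {Ψ₂ : L} (h₂ : (g : X → ℝ) ≤ Ψ₂) : sandwichFunctional hS hL g ≤ S Ψ₂ := by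
  obtain ⟨Ψ₁, -, h₁, -, -⟩ := hL g 1 one_pos
  exact upperExtension_le hS ⟨Ψ₁, h₁⟩ h₂

/-- `sandwichFunctional` agrees with `S` on `L ∩ C_c(X, ℝ)`. [cite: Rudin1987, Ch. 2, Thm. 2.14] -/
theorem sandwichFunctional_eq_of_coe_eq
 {g : C_c(X, ℝ)} {Ψ : L} (h : (g : X → ℝ) = Ψ) :
    sandwichFunctional hS hL g = S Ψ :=
  le_antisymm (sandwichFunctional_le hS hL h.le) (le_sandwichFunctional hS hL h.ge)

/-- `|Λ g - S Ψ| ≤ S Θ` when `|g - Ψ| ≤ Θ` pointwise (`Ψ, Θ ∈ L`): the functional is squeezed by the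
sandwich `Ψ - Θ ≤ g ≤ Ψ + Θ`. [cite: Rudin1987, Ch. 2, Thm. 2.14] -/
theorem abs_sandwichFunctional_sub_le
 {g : C_c(X, ℝ)} {Ψ Θ : L}
    (h : ∀ x, |g x - (Ψ : X → ℝ) x| ≤ (Θ : X → ℝ) x) :
    |sandwichFunctional hS hL g - S Ψ| ≤ S Θ := by
  rw [abs_le]
  constructor
  · have hlow : ((Ψ - Θ : L) : X → ℝ) ≤ g := fun x => by
      simp only [Submodule.coe_sub, Pi.sub_apply]
      have := (abs_le.mp (h x)).1
      linarith
    have := le_sandwichFunctional hS hL hlow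
    rw [map_sub] at this
    linarith
  · have hup : (g : X → ℝ) ≤ ((Ψ + Θ : L) : X → ℝ) := fun x => by
      simp only [Submodule.coe_add, Pi.add_apply]
      have := (abs_le.mp (h x)).2
      linarith
    have := sandwichFunctional_le hS hL hup
    rw [map_add] at this
    linarith

/-- Invariance of `sandwichFunctional` under a homeomorphism `T` preserving `L` and `S`:
`Λ (g ∘ T) = Λ g`. [cite: Weil1965, Chap. I n° 2, Lemme 3, p. 7] -/
theorem sandwichFunctional_comp_homeomorph
 (T : X ≃ₜ X) (hT : ∀ Ψ : L, (Ψ : X → ℝ) ∘ T ∈ L)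
    (hTS : ∀ Ψ : L, S ⟨(Ψ : X → ℝ) ∘ T, hT Ψ⟩ = S Ψ) (g : C_c(X, ℝ)) :
    sandwichFunctional hS hL ⟨(g : C(X, ℝ)).comp (T : C(X, X)),
        g.hasCompactSupport.comp_homeomorph T⟩ = sandwichFunctional hS hL g := by
  set gT : C_c(X, ℝ) := ⟨(g : C(X, ℝ)).comp (T : C(X, X)), g.hasCompactSupport.comp_homeomorph T⟩
  have hgT : ∀ x, gT x = g (T x) := fun _ => rfl
  refine le_antisymm (le_of_forall_pos_le_add fun ε hε => ?_)
    (le_of_forall_pos_le_add fun ε hε => ?_)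
  · obtain ⟨Ψ₁, Ψ₂, h₁, h₂, h, hl, hu⟩ := exists_sandwich hS hL g hε
    have hup : (gT : X → ℝ) ≤ ((⟨(Ψ₂ : X → ℝ) ∘ T, hT Ψ₂⟩ : L) : X → ℝ) := fun x => by
      rw [hgT]
      exact h₂ (T x)
    calc sandwichFunctional hS hL gT ≤ S ⟨(Ψ₂ : X → ℝ) ∘ T, hT Ψ₂⟩ :=
          sandwichFunctional_le hS hL hup
      _ = S Ψ₂ := hTS Ψ₂
      _ ≤ sandwichFunctional hS hL g + ε := by rw [sandwichFunctional_apply]; linarith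
  · obtain ⟨Ψ₁, Ψ₂, h₁, h₂, h, hl, hu⟩ := exists_sandwich hS hL g hε
    have hlow : ((⟨(Ψ₁ : X → ℝ) ∘ T, hT Ψ₁⟩ : L) : X → ℝ) ≤ gT := fun x => by
      rw [hgT]
      exact h₁ (T x)
    calc sandwichFunctional hS hL g ≤ S Ψ₁ + ε := by rw [sandwichFunctional_apply]; linarith
      _ = S ⟨(Ψ₁ : X → ℝ) ∘ T, hT Ψ₁⟩ + ε := by rw [hTS Ψ₁]
      _ ≤ sandwichFunctional hS hL gT + ε := by
        have := le_sandwichFunctional hS hL hlow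
        linarith

end Daniell

/-! ### The Radon measure of a sandwiching positive functional -/

section Measure

variable [TopologicalSpace X] [T2Space X] [LocallyCompactSpace X] [MeasurableSpace X] [BorelSpace X]
variable {L : Submodule ℝ (X → ℝ)} {S : L →ₗ[ℝ] ℝ}
variable (hS : ∀ Ψ : L, 0 ≤ (Ψ : X → ℝ) → 0 ≤ S Ψ)
  (hL : ∀ g : C_c(X, ℝ), ∀ ε : ℝ, 0 < ε →
    ∃ Ψ₁ Ψ₂ : L, (Ψ₁ : X → ℝ) ≤ g ∧ (g : X → ℝ) ≤ Ψ₂ ∧ S Ψ₂ ≤ S Ψ₁ + ε)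

include hS hL

/-- **The positive Radon measure of a sandwiching positive functional**: the Riesz–Markov–Kakutani
measure of `sandwichFunctional` (Mathlib `RealRMK.rieszMeasure`).
[cite: Rudin1987, Ch. 2, Thm. 2.14] -/
def sandwichMeasure :
    Measure X :=
  RealRMK.rieszMeasure (sandwichFunctional hS hL)

/-- `sandwichMeasure` is a regular Borel measure. [cite: Rudin1987, Ch. 2, Thm. 2.14 & Thm. 2.18] -/
theorem regular_sandwichMeasure
 : (sandwichMeasure hS hL).Regular :=
  RealRMK.regular_rieszMeasure _

/-- **Riesz–Markov–Kakutani**: `∫ g dν = Λ g` for every test function `g ∈ C_c(X, ℝ)`.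
[cite: Rudin1987, Ch. 2, Thm. 2.14] -/
theorem integral_sandwichMeasure
 (g : C_c(X, ℝ)) :
    ∫ x, g x ∂(sandwichMeasure hS hL) = sandwichFunctional hS hL g :=
  RealRMK.integral_rieszMeasure _ g

/-- `∫ g dν = S Ψ` for a test function `g` that lies in `L` (as `Ψ`).
[cite: Rudin1987, Ch. 2, Thm. 2.14] -/
theorem integral_sandwichMeasure_eq_of_coe_eq
 {g : C_c(X, ℝ)} {Ψ : L} (h : (g : X → ℝ) = Ψ) :
    ∫ x, g x ∂(sandwichMeasure hS hL) = S Ψ := by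
  rw [integral_sandwichMeasure, sandwichFunctional_eq_of_coe_eq hS hL h]

omit [MeasurableSpace X] [BorelSpace X] hS hL in
/-- An auxiliary Urysohn function: for a compact `K` inside an open `U` there is a test function
`f ∈ C_c(X, ℝ)`, `0 ≤ f ≤ 1`, `f = 1` on `K`, `tsupport f ⊆ U`. [cite: Rudin1987, Ch. 2, Lemma 2.12] -/
theorem exists_compactlySupported_one_of_isCompact {K U : Set X} (hK : IsCompact K) (hU : IsOpen U)
    (hKU : K ⊆ U) : ∃ f : C_c(X, ℝ), tsupport f ⊆ U ∧ EqOn f 1 K ∧ ∀ x, f x ∈ Icc (0 : ℝ) 1 := by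
  obtain ⟨V, hVo, hKV, hVc⟩ := exists_isOpen_superset_and_isCompact_closure hK
  have hWc : IsCompact (closure (V ∩ U)) :=
    hVc.of_isClosed_subset isClosed_closure (closure_mono inter_subset_left)
  obtain ⟨f, hfW, hfK, hf01⟩ := exists_tsupport_one_of_isOpen_isClosed (hVo.inter hU) hWc
    hK.isClosed (subset_inter hKV hKU)
  have hfc : HasCompactSupport f :=
    hWc.of_isClosed_subset (isClosed_tsupport _) (hfW.trans subset_closure)
  exact ⟨⟨f, hfc⟩, hfW.trans inter_subset_right, hfK, hf01⟩

/-- **`∫_K Ψ dν ≤ S Ψ`** on every compact `K`, for a continuous nonnegative `Ψ ∈ L`: the test function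
`Ψ · f_K` (`f_K` a Urysohn function of `K`) lies below `Ψ`. [cite: Rudin1987, Ch. 2, Thm. 2.14] -/
theorem setLIntegral_sandwichMeasure_le
 (Ψ : L) (hc : Continuous (Ψ : X → ℝ)) (h0 : 0 ≤ (Ψ : X → ℝ))
    {K : Set X} (hK : IsCompact K) :
    ∫⁻ x in K, ENNReal.ofReal ((Ψ : X → ℝ) x) ∂(sandwichMeasure hS hL) ≤ ENNReal.ofReal (S Ψ) := by
  haveI := regular_sandwichMeasure hS hL
  obtain ⟨f, -, hfK, hf01⟩ := exists_compactlySupported_one_of_isCompact hK isOpen_univ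
    (subset_univ K)
  set g : C_c(X, ℝ) := ⟨⟨fun x => (Ψ : X → ℝ) x * f x, hc.mul f.continuous⟩,
    f.hasCompactSupport.mul_left⟩
  have hg : ∀ x, g x = (Ψ : X → ℝ) x * f x := fun _ => rfl
  have hg0 : ∀ x, 0 ≤ g x := fun x => by rw [hg]; exact mul_nonneg (h0 x) (hf01 x).1
  have hgΨ : (g : X → ℝ) ≤ (Ψ : X → ℝ) := fun x => by
    rw [hg]
    exact (mul_le_mul_of_nonneg_left (hf01 x).2 (h0 x)).trans_eq (mul_one _)
  calc ∫⁻ x in K, ENNReal.ofReal ((Ψ : X → ℝ) x) ∂(sandwichMeasure hS hL)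
      = ∫⁻ x in K, ENNReal.ofReal (g x) ∂(sandwichMeasure hS hL) := by
        refine setLIntegral_congr_fun hK.measurableSet fun x hx => ?_
        rw [hg, show f x = 1 from hfK hx, mul_one]
    _ ≤ ∫⁻ x, ENNReal.ofReal (g x) ∂(sandwichMeasure hS hL) := setLIntegral_le_lintegral _ _
    _ = ENNReal.ofReal (∫ x, g x ∂(sandwichMeasure hS hL)) :=
        (ofReal_integral_eq_lintegral_ofReal g.integrable (ae_of_all _ hg0)).symm
    _ ≤ ENNReal.ofReal (S Ψ) := by
        rw [integral_sandwichMeasure]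
        exact ENNReal.ofReal_le_ofReal (sandwichFunctional_le hS hL hgΨ)

/-- Compact sets have `sandwichMeasure` at most `S Ψ` for any continuous nonnegative `Ψ ∈ L` which is
`≥ 1` on the set. [cite: Rudin1987, Ch. 2, Thm. 2.14] -/
theorem sandwichMeasure_le_of_isCompact
 {K : Set X} (hK : IsCompact K) (Ψ : L) (hc : Continuous (Ψ : X → ℝ))
    (h0 : 0 ≤ (Ψ : X → ℝ)) (h1 : ∀ x ∈ K, 1 ≤ (Ψ : X → ℝ) x) :
    sandwichMeasure hS hL K ≤ ENNReal.ofReal (S Ψ) := by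
  calc sandwichMeasure hS hL K = ∫⁻ x in K, 1 ∂(sandwichMeasure hS hL) := by
        rw [setLIntegral_one]
    _ ≤ ∫⁻ x in K, ENNReal.ofReal ((Ψ : X → ℝ) x) ∂(sandwichMeasure hS hL) := by
        refine setLIntegral_mono' hK.measurableSet fun x hx => ?_
        rw [← ENNReal.ofReal_one]
        exact ENNReal.ofReal_le_ofReal (h1 x hx)
    _ ≤ ENNReal.ofReal (S Ψ) := setLIntegral_sandwichMeasure_le hS hL Ψ hc h0 hK

/-- **`∫ Ψ dν ≤ S Ψ`** (as a lower Lebesgue integral) for a continuous nonnegative `Ψ ∈ L` on a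
`σ`-compact space. [cite: Rudin1987, Ch. 2, Thm. 2.14] -/
theorem lintegral_sandwichMeasure_le [SigmaCompactSpace X]
 (Ψ : L)
    (hc : Continuous (Ψ : X → ℝ)) (h0 : 0 ≤ (Ψ : X → ℝ)) :
    ∫⁻ x, ENNReal.ofReal ((Ψ : X → ℝ) x) ∂(sandwichMeasure hS hL) ≤ ENNReal.ofReal (S Ψ) := by
  set F : ℕ → X → ENNReal := fun n => (compactCovering X n).indicator
    fun x => ENNReal.ofReal ((Ψ : X → ℝ) x)
  have hFm : ∀ n, Measurable (F n) := fun n =>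
    (ENNReal.measurable_ofReal.comp hc.measurable).indicator
      (isCompact_compactCovering X n).measurableSet
  have hFmono : Monotone F := fun m n hmn x =>
    indicator_le_indicator_of_subset (compactCovering_subset X hmn) (fun _ => zero_le) x
  have hF : (fun x => ENNReal.ofReal ((Ψ : X → ℝ) x)) = fun x => ⨆ n, F n x := by
    funext x
    obtain ⟨n, hn⟩ := exists_mem_compactCovering x
    refine le_antisymm (le_iSup_of_le n ?_) (iSup_le fun m => ?_)
    · simp only [F, indicator_of_mem hn, le_refl]
    · exact indicator_le_self _ _ x
  rw [hF, lintegral_iSup hFm hFmono]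
  refine iSup_le fun n => ?_
  simp only [F, lintegral_indicator (isCompact_compactCovering X n).measurableSet]
  exact setLIntegral_sandwichMeasure_le hS hL Ψ hc h0 (isCompact_compactCovering X n)

/-- A continuous nonnegative `Ψ ∈ L` is `ν`-integrable on a `σ`-compact space.
[cite: Rudin1987, Ch. 2, Thm. 2.14] -/
theorem integrable_sandwichMeasure_of_mem [SigmaCompactSpace X]
 (Ψ : L)
    (hc : Continuous (Ψ : X → ℝ)) (h0 : 0 ≤ (Ψ : X → ℝ)) :
    Integrable (Ψ : X → ℝ) (sandwichMeasure hS hL) := by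
  refine ⟨hc.aestronglyMeasurable, ?_⟩
  refine (hasFiniteIntegral_iff_ofReal (ae_of_all _ h0)).mpr ?_
  exact (lintegral_sandwichMeasure_le hS hL Ψ hc h0).trans_lt ENNReal.ofReal_lt_top

/-- **`∫ Ψ dν ≤ S Ψ`** for a continuous nonnegative `Ψ ∈ L` on a `σ`-compact space.
[cite: Rudin1987, Ch. 2, Thm. 2.14] -/
theorem integral_sandwichMeasure_le_of_mem [SigmaCompactSpace X]
 (Ψ : L)
    (hc : Continuous (Ψ : X → ℝ)) (h0 : 0 ≤ (Ψ : X → ℝ)) :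
    ∫ x, (Ψ : X → ℝ) x ∂(sandwichMeasure hS hL) ≤ S Ψ := by
  rw [integral_eq_lintegral_of_nonneg_ae (ae_of_all _ h0) hc.aestronglyMeasurable]
  exact ENNReal.toReal_le_of_le_ofReal (hS Ψ h0) (lintegral_sandwichMeasure_le hS hL Ψ hc h0)

/-- A continuous `Ψ ∈ L` dominated by a continuous `Θ ∈ L` (`|Ψ| ≤ Θ`) is `ν`-integrable with
`|∫ Ψ dν| ≤ S Θ`, on a `σ`-compact space. [cite: Rudin1987, Ch. 2, Thm. 2.14] -/
theorem integrable_sandwichMeasure_of_abs_le [SigmaCompactSpace X]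
 (Ψ Θ : L)
    (hc : Continuous (Ψ : X → ℝ)) (hΘc : Continuous (Θ : X → ℝ))
    (h : ∀ x, |(Ψ : X → ℝ) x| ≤ (Θ : X → ℝ) x) :
    Integrable (Ψ : X → ℝ) (sandwichMeasure hS hL) ∧
      |∫ x, (Ψ : X → ℝ) x ∂(sandwichMeasure hS hL)| ≤ S Θ := by
  have hΘ0 : 0 ≤ (Θ : X → ℝ) := fun x => (abs_nonneg _).trans (h x)
  have hΘi := integrable_sandwichMeasure_of_mem hS hL Θ hΘc hΘ0
  have hΨi : Integrable (Ψ : X → ℝ) (sandwichMeasure hS hL) :=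
    hΘi.mono hc.aestronglyMeasurable (ae_of_all _ fun x => by
      rw [Real.norm_eq_abs, Real.norm_eq_abs, abs_of_nonneg (hΘ0 x)]
      exact h x)
  refine ⟨hΨi, ?_⟩
  calc |∫ x, (Ψ : X → ℝ) x ∂(sandwichMeasure hS hL)|
      ≤ ∫ x, |(Ψ : X → ℝ) x| ∂(sandwichMeasure hS hL) := by
        rw [← Real.norm_eq_abs]
        exact (norm_integral_le_integral_norm _).trans_eq
          (integral_congr_ae (ae_of_all _ fun x => Real.norm_eq_abs _))
    _ ≤ ∫ x, (Θ : X → ℝ) x ∂(sandwichMeasure hS hL) :=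
        integral_mono hΨi.abs hΘi h
    _ ≤ S Θ := integral_sandwichMeasure_le_of_mem hS hL Θ hΘc hΘ0

/-- **`∫ Ψ dν = S Ψ` under tightness**: if `Ψ ∈ L` is continuous and, for every `ε > 0`, there are a
compactly supported continuous `Ψ' ∈ L` and a continuous `Θ ∈ L` with `|Ψ - Ψ'| ≤ Θ` and `S Θ ≤ ε`,
then `Ψ` is `ν`-integrable and `∫ Ψ dν = S Ψ` (`σ`-compact `X`).
[cite: Weil1965, Chap. I n° 2, Lemme 3, p. 7] -/
theorem integral_sandwichMeasure_eq_of_mem [SigmaCompactSpace X]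
 (Ψ : L)
    (hc : Continuous (Ψ : X → ℝ))
    (h : ∀ ε : ℝ, 0 < ε → ∃ Ψ' Θ : L, Continuous (Ψ' : X → ℝ) ∧ HasCompactSupport (Ψ' : X → ℝ) ∧
      Continuous (Θ : X → ℝ) ∧ (∀ x, |(Ψ : X → ℝ) x - (Ψ' : X → ℝ) x| ≤ (Θ : X → ℝ) x) ∧ S Θ ≤ ε) :
    Integrable (Ψ : X → ℝ) (sandwichMeasure hS hL) ∧
      ∫ x, (Ψ : X → ℝ) x ∂(sandwichMeasure hS hL) = S Ψ := by
  haveI := regular_sandwichMeasure hS hL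
  have key : ∀ ε : ℝ, 0 < ε → Integrable (Ψ : X → ℝ) (sandwichMeasure hS hL) ∧
      |∫ x, (Ψ : X → ℝ) x ∂(sandwichMeasure hS hL) - S Ψ| ≤ 2 * ε := by
    intro ε hε
    obtain ⟨Ψ', Θ, hΨ'c, hΨ's, hΘc, hle, hSΘ⟩ := h ε hε
    have hdiff : ∀ x, |((Ψ - Ψ' : L) : X → ℝ) x| ≤ (Θ : X → ℝ) x := fun x => by
      simpa only [Submodule.coe_sub, Pi.sub_apply] using hle x
    obtain ⟨hdi, hdI⟩ := integrable_sandwichMeasure_of_abs_le hS hL (Ψ - Ψ') Θ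
      (by simpa only [Submodule.coe_sub] using hc.sub hΨ'c) hΘc hdiff
    set g : C_c(X, ℝ) := ⟨⟨(Ψ' : X → ℝ), hΨ'c⟩, hΨ's⟩
    have hgi : Integrable (Ψ' : X → ℝ) (sandwichMeasure hS hL) := g.integrable
    have hgI : ∫ x, (Ψ' : X → ℝ) x ∂(sandwichMeasure hS hL) = S Ψ' :=
      integral_sandwichMeasure_eq_of_coe_eq hS hL (g := g) rfl
    have hΨi : Integrable (Ψ : X → ℝ) (sandwichMeasure hS hL) := by
      have := hdi.add hgi
      simpa only [Submodule.coe_sub, sub_add_cancel] using this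
    refine ⟨hΨi, ?_⟩
    have hsplit : ∫ x, (Ψ : X → ℝ) x ∂(sandwichMeasure hS hL) - S Ψ =
        (∫ x, ((Ψ - Ψ' : L) : X → ℝ) x ∂(sandwichMeasure hS hL)) - S (Ψ - Ψ') := by
      rw [map_sub, Submodule.coe_sub, integral_sub' hΨi hgi]
      simp only [hgI]
      ring
    have hSd : |S (Ψ - Ψ')| ≤ S Θ := abs_apply_le hS hdiff
    rw [hsplit]
    calc |(∫ x, ((Ψ - Ψ' : L) : X → ℝ) x ∂(sandwichMeasure hS hL)) - S (Ψ - Ψ')|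
        ≤ |∫ x, ((Ψ - Ψ' : L) : X → ℝ) x ∂(sandwichMeasure hS hL)| + |S (Ψ - Ψ')| :=
          abs_sub _ _
      _ ≤ S Θ + S Θ := add_le_add hdI hSd
      _ ≤ 2 * ε := by linarith
  refine ⟨(key 1 one_pos).1, ?_⟩
  refine eq_of_abs_sub_nonpos (not_lt.mp fun hpos => ?_) |>.symm |>.symm
  have := (key (|∫ x, (Ψ : X → ℝ) x ∂(sandwichMeasure hS hL) - S Ψ| / 4) (by positivity)).2
  linarith

/-- **Support control**: an open set `U` such that `Λ g = 0` for every test function `g` with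
`tsupport g ⊆ U` is `ν`-null. [cite: Weil1965, Chap. I n° 2, Lemme 3, p. 7] -/
theorem sandwichMeasure_apply_eq_zero_of_forall
 {U : Set X} (hU : IsOpen U)
    (h : ∀ g : C_c(X, ℝ), tsupport g ⊆ U → sandwichFunctional hS hL g = 0) :
    sandwichMeasure hS hL U = 0 := by
  haveI := regular_sandwichMeasure hS hL
  rw [hU.measure_eq_iSup_isCompact (sandwichMeasure hS hL)]
  refine le_antisymm (iSup_le fun K => iSup_le fun hKU => iSup_le fun hK => ?_) (zero_le)
  obtain ⟨f, hfU, hfK, hf01⟩ := exists_compactlySupported_one_of_isCompact hK hU hKU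
  calc sandwichMeasure hS hL K ≤ ENNReal.ofReal (sandwichFunctional hS hL f) :=
        RealRMK.rieszMeasure_le_of_eq_one _ (fun x => (hf01 x).1) hK (fun x hx => hfK hx)
    _ = 0 := by rw [h f hfU, ENNReal.ofReal_zero]

/-- **Invariance**: a homeomorphism `T` with `L ∘ T ⊆ L` and `S (Ψ ∘ T) = S Ψ` preserves `ν`
(`ν.map T = ν`). [cite: Weil1965, Chap. I n° 2, Lemme 3, p. 7] -/
theorem map_sandwichMeasure_eq
    (T : X ≃ₜ X) (hT : ∀ Ψ : L, (Ψ : X → ℝ) ∘ T ∈ L)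
    (hTS : ∀ Ψ : L, S ⟨(Ψ : X → ℝ) ∘ T, hT Ψ⟩ = S Ψ) :
    (sandwichMeasure hS hL).map T = sandwichMeasure hS hL := by
  haveI := regular_sandwichMeasure hS hL
  haveI : ((sandwichMeasure hS hL).map T).Regular := Measure.Regular.map T
  refine Measure.ext_of_integral_eq_on_compactlySupported fun g => ?_
  rw [T.measurableEmbedding.integral_map]
  have := sandwichFunctional_comp_homeomorph hS hL T hT hTS g
  rw [← integral_sandwichMeasure, ← integral_sandwichMeasure] at this
  exact this

/-- **Invariance** as a `MeasurePreserving` statement. [cite: Weil1965, Chap. I n° 2, Lemme 3, p. 7] -/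
theorem measurePreserving_sandwichMeasure
 (T : X ≃ₜ X) (hT : ∀ Ψ : L, (Ψ : X → ℝ) ∘ T ∈ L)
    (hTS : ∀ Ψ : L, S ⟨(Ψ : X → ℝ) ∘ T, hT Ψ⟩ = S Ψ) :
    MeasurePreserving T (sandwichMeasure hS hL) (sandwichMeasure hS hL) :=
  ⟨T.continuous.measurable, map_sandwichMeasure_eq hS hL T hT hTS⟩

end Measure

end Literature.MeasureTheory.RieszRepresentation
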